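import Literature.Geometry.Lorentzian.KerrSchildCoord
import Literature.Geometry.Lorentzian.KerrSchildDivergence
import HarnessLib

/-!
# The Kerr–Schild metric on the equatorial hyperplane `{z = 0}`: closed forms and line derivatives
(family `gr`; infrastructure for the photon orbits of `KerrPhotonOrbit.lean`; namespace
`Literature.Geometry.Lorentzian.Kerr`)

On the hyperplane `{z = 0}` of the ingoing Kerr–Schild chart (`KerrSchild.lean`: `g = η + 2H ℓ ⊗ ℓ`,
`H = M r³/(r⁴ + a² z²)`, `ℓ = (1, (r x + a y)/(r² + a²), (r y − a x)/(r² + a²), z/r)`, `r` the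
Kerr–Schild radius) everything is explicit: outside the disc `{x² + y² ≤ a²}` one has
`r = √(x² + y² − a²)`, `H = M/r`, `r² + a² = x² + y²` and `ℓ(v) = v⁰ + ((r x + a y) v¹ +
(r y − a x) v²)/(x² + y²)` for `v` tangent to the hyperplane or not (the `z`-component of `ℓ`
vanishes). Kerr 1963; Visser arXiv:0706.0622, (33)–(35) with `z = 0`; O'Neill 1995, Ch. 2 (the
equatorial plane, `θ = π/2`). This file records these closed forms
(`Kerr.radius_of_apply_three_eq_zero`, `Kerr.scalarH_of_apply_three_eq_zero`,
`Kerr.nullCovector_apply_of_apply_three_eq_zero`, `Kerr.bilin_apply_of_apply_three_eq_zero`)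
and computes the **derivative of the metric components along a straight line in the hyperplane**,
`s ↦ g_{p + s v}(Y, Z)` for `p³ = v³ = 0` (`Kerr.hasDerivAt_bilin_line`, through the explicit
one-variable functions `Kerr.lineCylSq`, `Kerr.lineRadius`, `Kerr.lineEll`, `Kerr.lineBilin`),
together with the vanishing of the transversal derivative `∂_z g_p(w, w) = 0` for `w³ = 0`
(`Kerr.fderiv_bilin_basisVector_three_eq_zero`, from the reflection symmetry `z ↦ −z`) and of the
time derivative (stationarity, `KerrSchildCoord.lean`). These are the ingredients of the
Christoffel symbols `Γ(w, w)`, `2 g(Γ(w, w), Z) = 2 ∂_w g(w, Z) − ∂_Z g(w, w)`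
(`OpensChart.two_mul_val_christoffel`), along curves in the equatorial hyperplane, in particular
along the circular photon orbits.

## References

* R. P. Kerr, PRL 11 (1963) 237, eq. (5); M. Visser, arXiv:0706.0622, (32)–(35)
  (key `arXiv07060622`).
* B. O'Neill, *The geometry of Kerr black holes*, 1995, Ch. 2 and Ch. 4 (equatorial geodesics)
  (key `ONeill1995`).
-/

noncomputable section

open Set Filter
open scoped Topology

namespace Literature.Geometry.Lorentzian

namespace Kerr

/-! ### Closed forms on `{z = 0}` -/

/-- On `{z = 0}`, outside the disc, the Kerr–Schild radius is `r = √(x² + y² − a²)` (the positive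
root of `r⁴ − (ρ² − a²) r² = 0`). Visser arXiv:0706.0622, (35) with `z = 0`.
[cite: arXiv07060622, (35)] -/
theorem radius_of_apply_three_eq_zero {a : ℝ} {x : E4} (h3 : x 3 = 0)
    (ha : a ^ 2 < x 1 ^ 2 + x 2 ^ 2) : radius a x = √(x 1 ^ 2 + x 2 ^ 2 - a ^ 2) := by
  have hpos : 0 < √(x 1 ^ 2 + x 2 ^ 2 - a ^ 2) := Real.sqrt_pos.2 (by linarith)
  refine radius_eq_of_pos_of_quartic hpos ?_
  have hsq : √(x 1 ^ 2 + x 2 ^ 2 - a ^ 2) ^ 2 = x 1 ^ 2 + x 2 ^ 2 - a ^ 2 :=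
    Real.sq_sqrt (by linarith)
  rw [E4.spatialNorm_sq, h3, show √(x 1 ^ 2 + x 2 ^ 2 - a ^ 2) ^ 4 =
    (√(x 1 ^ 2 + x 2 ^ 2 - a ^ 2) ^ 2) ^ 2 by ring, hsq]
  ring

/-- On `{z = 0}` (where `r > 0`) the Kerr–Schild scalar is `H = M/r`. Visser arXiv:0706.0622,
(33) with `z = 0`. [cite: arXiv07060622, (33)] -/
theorem scalarH_of_apply_three_eq_zero (M : ℝ) {a : ℝ} {x : E4} (h3 : x 3 = 0)
    (hr : 0 < radius a x) : scalarH M a x = M / radius a x := by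
  unfold scalarH
  rw [h3]
  have hr0 : radius a x ≠ 0 := hr.ne'
  field_simp
  ring

/-- The null covector unfolded: `ℓ(v) = v⁰ + ℓ₁ v¹ + ℓ₂ v² + ℓ₃ v³` with the components of
`Kerr.nullCovectorFun`. Visser arXiv:0706.0622, (34). [cite: arXiv07060622, (34)] -/
theorem nullCovector_apply (a : ℝ) (x v : E4) :
    nullCovector a x v = v 0 + (radius a x * x 1 + a * x 2) / (radius a x ^ 2 + a ^ 2) * v 1 +
      (radius a x * x 2 - a * x 1) / (radius a x ^ 2 + a ^ 2) * v 2 + x 3 / radius a x * v 3 := by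
  simp [nullCovector, nullCovectorFun, Fin.sum_univ_four]

/-- On `{z = 0}`, outside the disc: `ℓ(v) = v⁰ + ((r x + a y) v¹ + (r y − a x) v²)/(x² + y²)`
(`r² + a² = x² + y²`, `ℓ₃ = z/r = 0`). Visser arXiv:0706.0622, (34)–(35) with `z = 0`.
[cite: arXiv07060622, (34)] -/
theorem nullCovector_apply_of_apply_three_eq_zero {a : ℝ} {x : E4} (h3 : x 3 = 0)
    (ha : a ^ 2 < x 1 ^ 2 + x 2 ^ 2) (v : E4) :
    nullCovector a x v = v 0 + ((radius a x * x 1 + a * x 2) * v 1 +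
      (radius a x * x 2 - a * x 1) * v 2) / (x 1 ^ 2 + x 2 ^ 2) := by
  have hr2 : radius a x ^ 2 + a ^ 2 = x 1 ^ 2 + x 2 ^ 2 := by
    rw [radius_of_apply_three_eq_zero h3 ha, Real.sq_sqrt (by linarith)]
    ring
  rw [nullCovector_apply, h3, hr2]
  have hne : x 1 ^ 2 + x 2 ^ 2 ≠ 0 := by
    have : 0 ≤ a ^ 2 := sq_nonneg a
    linarith
  field_simp
  ring

/-- **The Kerr–Schild metric on `{z = 0}`, outside the disc**:
`g_x(Y, Z) = η(Y, Z) + 2 (M/r) ℓ(Y) ℓ(Z)` with `ℓ` as in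
`nullCovector_apply_of_apply_three_eq_zero`. Kerr 1963, eq. (5); Visser arXiv:0706.0622, (32) with
`z = 0`. [cite: arXiv07060622, (32)] -/
theorem bilin_apply_of_apply_three_eq_zero (M : ℝ) {a : ℝ} {x : E4} (h3 : x 3 = 0)
    (ha : a ^ 2 < x 1 ^ 2 + x 2 ^ 2) (Y Z : E4) :
    bilin M a x Y Z = Minkowski.bilin Y Z + 2 * (M / radius a x *
      ((Y 0 + ((radius a x * x 1 + a * x 2) * Y 1 + (radius a x * x 2 - a * x 1) * Y 2) /
          (x 1 ^ 2 + x 2 ^ 2)) *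
        (Z 0 + ((radius a x * x 1 + a * x 2) * Z 1 + (radius a x * x 2 - a * x 1) * Z 2) /
          (x 1 ^ 2 + x 2 ^ 2)))) := by
  have hr : 0 < radius a x := by
    rw [radius_of_apply_three_eq_zero h3 ha]
    exact Real.sqrt_pos.2 (by linarith)
  rw [bilin_apply, scalarH_of_apply_three_eq_zero M h3 hr,
    nullCovector_apply_of_apply_three_eq_zero h3 ha,
    nullCovector_apply_of_apply_three_eq_zero h3 ha]
  ring

/-! ### Straight lines in the hyperplane `{z = 0}`: explicit one-variable functions -/

section Line

variable (M a : ℝ) (p v : E4)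

/-- The squared cylindrical radius `x² + y²` along the line `s ↦ p + s v`. [folklore] -/
def lineCylSq (s : ℝ) : ℝ := (p 1 + s * v 1) ^ 2 + (p 2 + s * v 2) ^ 2

/-- The Kerr–Schild radius `√(x² + y² − a²)` along a line in `{z = 0}`. Visser
arXiv:0706.0622, (35). [cite: arXiv07060622, (35)] -/
def lineRadius (s : ℝ) : ℝ := √(lineCylSq p v s - a ^ 2)

/-- The null covector applied to a fixed vector `Y`, `ℓ_{p + s v}(Y)`, along a line in `{z = 0}`
(closed form of `nullCovector_apply_of_apply_three_eq_zero`). Visser arXiv:0706.0622, (34).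
[cite: arXiv07060622, (34)] -/
def lineEll (Y : E4) (s : ℝ) : ℝ :=
  Y 0 + ((lineRadius a p v s * (p 1 + s * v 1) + a * (p 2 + s * v 2)) * Y 1 +
    (lineRadius a p v s * (p 2 + s * v 2) - a * (p 1 + s * v 1)) * Y 2) / lineCylSq p v s

/-- The metric component `g_{p + s v}(Y, Z)` along a line in `{z = 0}` (closed form of
`bilin_apply_of_apply_three_eq_zero`). Visser arXiv:0706.0622, (32). [cite: arXiv07060622, (32)] -/
def lineBilin (Y Z : E4) (s : ℝ) : ℝ :=
  Minkowski.bilin Y Z + 2 * (M / lineRadius a p v s * (lineEll a p v Y s * lineEll a p v Z s))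

variable {M a p v}

/-- Coordinates along the line. [folklore] -/
theorem line_apply (s : ℝ) (μ : Fin 4) : (p + s • v) μ = p μ + s * v μ := by
  simp

/-- Along a line in `{z = 0}` outside the disc the metric components are `lineBilin`.
[cite: arXiv07060622, (32)] -/
theorem bilin_line_eq (hp3 : p 3 = 0) (hv3 : v 3 = 0) {s : ℝ} (hs : a ^ 2 < lineCylSq p v s)
    (Y Z : E4) : bilin M a (p + s • v) Y Z = lineBilin M a p v Y Z s := by
  have h3 : (p + s • v) 3 = 0 := by rw [line_apply, hp3, hv3]; ring
  have hs' : a ^ 2 < (p + s • v) 1 ^ 2 + (p + s • v) 2 ^ 2 := by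
    rw [line_apply, line_apply]; exact hs
  rw [bilin_apply_of_apply_three_eq_zero M h3 hs', radius_of_apply_three_eq_zero h3 hs']
  simp only [lineBilin, lineEll, lineRadius, lineCylSq, line_apply]

/-- Derivative of the squared cylindrical radius along the line at `s = 0`. [folklore] -/
theorem hasDerivAt_lineCylSq :
    HasDerivAt (lineCylSq p v) (2 * (p 1 * v 1 + p 2 * v 2)) 0 := by
  have h1 : HasDerivAt (fun s : ℝ ↦ p 1 + s * v 1) (v 1) 0 := by
    simpa using ((hasDerivAt_id (0 : ℝ)).mul_const (v 1)).const_add (p 1)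
  have h2 : HasDerivAt (fun s : ℝ ↦ p 2 + s * v 2) (v 2) 0 := by
    simpa using ((hasDerivAt_id (0 : ℝ)).mul_const (v 2)).const_add (p 2)
  have h := (h1.mul h1).add (h2.mul h2)
  have hfun : lineCylSq p v = fun s ↦ (p 1 + s * v 1) * (p 1 + s * v 1) +
      (p 2 + s * v 2) * (p 2 + s * v 2) := by
    funext s; simp only [lineCylSq]; ring
  rw [hfun]
  refine h.congr_deriv ?_
  simp only [zero_mul, add_zero]
  ring

/-- Derivative of the Kerr–Schild radius along a line in `{z = 0}` at `s = 0`: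
`r' = (x v¹ + y v²)/r`. Visser arXiv:0706.0622, (35). [cite: arXiv07060622, (35)] -/
theorem hasDerivAt_lineRadius (ha : a ^ 2 < p 1 ^ 2 + p 2 ^ 2) :
    HasDerivAt (lineRadius a p v) ((p 1 * v 1 + p 2 * v 2) / lineRadius a p v 0) 0 := by
  have h0 : lineCylSq p v 0 = p 1 ^ 2 + p 2 ^ 2 := by simp [lineCylSq]
  have hne : lineCylSq p v 0 - a ^ 2 ≠ 0 := by rw [h0]; linarith
  have h := (hasDerivAt_lineCylSq (p := p) (v := v)).sub_const (a ^ 2) |>.sqrt hne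
  refine h.congr_deriv ?_
  simp only [lineRadius]
  have hr : √(lineCylSq p v 0 - a ^ 2) ≠ 0 :=
    (Real.sqrt_pos.2 (by rw [h0]; linarith)).ne'
  field_simp

/-- The value of `lineEll` at `s = 0`. [folklore] -/
theorem lineEll_zero (Y : E4) : lineEll a p v Y 0 = Y 0 +
    ((lineRadius a p v 0 * p 1 + a * p 2) * Y 1 + (lineRadius a p v 0 * p 2 - a * p 1) * Y 2) /
      (p 1 ^ 2 + p 2 ^ 2) := by
  simp [lineEll, lineCylSq]

/-- **Derivative of `ℓ_{p + s v}(Y)` along a line in `{z = 0}` at `s = 0`** (quotient rule with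
`r' = (x v¹ + y v²)/r`, `(x² + y²)' = 2(x v¹ + y v²)`). Visser arXiv:0706.0622, (34)–(35).
[cite: arXiv07060622, (34)] -/
theorem hasDerivAt_lineEll (ha : a ^ 2 < p 1 ^ 2 + p 2 ^ 2) (Y : E4) :
    HasDerivAt (lineEll a p v Y)
      ((((p 1 * v 1 + p 2 * v 2) / lineRadius a p v 0 * p 1 + lineRadius a p v 0 * v 1 +
            a * v 2) * Y 1 +
          ((p 1 * v 1 + p 2 * v 2) / lineRadius a p v 0 * p 2 + lineRadius a p v 0 * v 2 -
            a * v 1) * Y 2) / (p 1 ^ 2 + p 2 ^ 2) -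
        ((lineRadius a p v 0 * p 1 + a * p 2) * Y 1 + (lineRadius a p v 0 * p 2 - a * p 1) * Y 2) *
          (2 * (p 1 * v 1 + p 2 * v 2)) / (p 1 ^ 2 + p 2 ^ 2) ^ 2) 0 := by
  have h0 : lineCylSq p v 0 = p 1 ^ 2 + p 2 ^ 2 := by simp [lineCylSq]
  have hne : lineCylSq p v 0 ≠ 0 := by
    rw [h0]; have := sq_nonneg a; linarith
  have hr := hasDerivAt_lineRadius (a := a) (p := p) (v := v) ha
  have h1 : HasDerivAt (fun s : ℝ ↦ p 1 + s * v 1) (v 1) 0 := by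
    simpa using ((hasDerivAt_id (0 : ℝ)).mul_const (v 1)).const_add (p 1)
  have h2 : HasDerivAt (fun s : ℝ ↦ p 2 + s * v 2) (v 2) 0 := by
    simpa using ((hasDerivAt_id (0 : ℝ)).mul_const (v 2)).const_add (p 2)
  -- the numerator
  have hN : HasDerivAt (fun s ↦ (lineRadius a p v s * (p 1 + s * v 1) + a * (p 2 + s * v 2)) * Y 1
      + (lineRadius a p v s * (p 2 + s * v 2) - a * (p 1 + s * v 1)) * Y 2)
      ((((p 1 * v 1 + p 2 * v 2) / lineRadius a p v 0 * (p 1 + 0 * v 1) +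
          lineRadius a p v 0 * v 1 + a * v 2) * Y 1) +
        (((p 1 * v 1 + p 2 * v 2) / lineRadius a p v 0 * (p 2 + 0 * v 2) +
          lineRadius a p v 0 * v 2 - a * v 1) * Y 2)) 0 :=
    (((hr.mul h1).add (h2.const_mul a)).mul_const (Y 1)).add
      (((hr.mul h2).sub (h1.const_mul a)).mul_const (Y 2))
  have hq := (hN.div hasDerivAt_lineCylSq hne).const_add (Y 0)
  refine (hq.congr_of_eventuallyEq (Eventually.of_forall fun s ↦ rfl)).congr_deriv ?_
  rw [h0]
  simp only [zero_mul, add_zero]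
  have hne' : p 1 ^ 2 + p 2 ^ 2 ≠ 0 := by rwa [h0] at hne
  field_simp

/-- **Derivative of the metric component `g_{p + s v}(Y, Z)` along a line in `{z = 0}` at
`s = 0`**: with `r = √(x² + y² − a²)`, `r' = (x v¹ + y v²)/r`, `H = M/r`, `H' = −M r'/r²` and
`L_Y = ℓ_p(Y)`, `L_Y'` from `hasDerivAt_lineEll`,
`d/ds g(Y, Z) = 2 (H' L_Y L_Z + H (L_Y' L_Z + L_Y L_Z'))`. This is `∂_v g_p(Y, Z)`
(`fderiv_bilin_apply_eq_of_hasDerivAt`), the raw material of the Christoffel symbols in the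
equatorial hyperplane. Kerr 1963; Visser arXiv:0706.0622, (32)–(35). [cite: arXiv07060622, (32)] -/
theorem hasDerivAt_lineBilin (ha : a ^ 2 < p 1 ^ 2 + p 2 ^ 2) (Y Z : E4) {dY dZ : ℝ}
    (hY : HasDerivAt (lineEll a p v Y) dY 0) (hZ : HasDerivAt (lineEll a p v Z) dZ 0) :
    HasDerivAt (lineBilin M a p v Y Z)
      (2 * (-(M * ((p 1 * v 1 + p 2 * v 2) / lineRadius a p v 0)) / lineRadius a p v 0 ^ 2 *
          (lineEll a p v Y 0 * lineEll a p v Z 0) +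
        M / lineRadius a p v 0 * (dY * lineEll a p v Z 0 + lineEll a p v Y 0 * dZ))) 0 := by
  have h0 : lineCylSq p v 0 = p 1 ^ 2 + p 2 ^ 2 := by simp [lineCylSq]
  have hr0 : lineRadius a p v 0 ≠ 0 := by
    simp only [lineRadius, h0]
    exact (Real.sqrt_pos.2 (by linarith)).ne'
  have hr := hasDerivAt_lineRadius (a := a) (p := p) (v := v) ha
  have hH : HasDerivAt (fun s ↦ M / lineRadius a p v s)
      ((0 * lineRadius a p v 0 - M * ((p 1 * v 1 + p 2 * v 2) / lineRadius a p v 0)) /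
        lineRadius a p v 0 ^ 2) 0 := (hasDerivAt_const 0 M).div hr hr0
  have h := ((hH.mul (hY.mul hZ)).const_mul 2).const_add (Minkowski.bilin Y Z)
  refine (h.congr_of_eventuallyEq (Eventually.of_forall fun s ↦ rfl)).congr_deriv ?_
  simp only [zero_mul, zero_sub, Pi.mul_apply]

/-- Near `s = 0` the line stays outside the disc if it starts outside. [folklore] -/
theorem eventually_lt_lineCylSq (ha : a ^ 2 < p 1 ^ 2 + p 2 ^ 2) :
    ∀ᶠ s in 𝓝 (0 : ℝ), a ^ 2 < lineCylSq p v s := by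
  have hc : Continuous (lineCylSq p v) := by unfold lineCylSq; fun_prop
  have h0 : lineCylSq p v 0 = p 1 ^ 2 + p 2 ^ 2 := by simp [lineCylSq]
  exact hc.continuousAt.eventually (lt_mem_nhds (by rw [h0]; exact ha))

/-- **The metric components along a line in `{z = 0}` have the derivative of `lineBilin`**:
`s ↦ g_{p + s v}(Y, Z)` agrees with `lineBilin` near `s = 0` (`bilin_line_eq`), for `p³ = v³ = 0`
and `p` outside the disc. [cite: arXiv07060622, (32)] -/
theorem hasDerivAt_bilin_line (hp3 : p 3 = 0) (hv3 : v 3 = 0) (ha : a ^ 2 < p 1 ^ 2 + p 2 ^ 2)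
    (Y Z : E4) {D : ℝ} (hD : HasDerivAt (lineBilin M a p v Y Z) D 0) :
    HasDerivAt (fun s : ℝ ↦ bilin M a (p + s • v) Y Z) D 0 := by
  refine hD.congr_of_eventuallyEq ?_
  filter_upwards [eventually_lt_lineCylSq (p := p) (v := v) ha] with s hs
  exact bilin_line_eq hp3 hv3 hs Y Z

/-- **The directional derivative of the metric components is the line derivative**: for
`G = g_{M,a}` differentiable at `p`, `(DG(p) v)(Y, Z) = d/ds|₀ g_{p + s v}(Y, Z)`. [folklore] -/
theorem fderiv_bilin_apply_eq_of_hasDerivAt {p v Y Z : E4} (hd : DifferentiableAt ℝ (bilin M a) p)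
    {D : ℝ} (hD : HasDerivAt (fun s : ℝ ↦ bilin M a (p + s • v) Y Z) D 0) :
    fderiv ℝ (bilin M a) p v Y Z = D := by
  have h1 : HasDerivAt (fun s : ℝ ↦ bilin M a (p + s • v) Y Z)
      (fderiv ℝ (fun y ↦ bilin M a y Y Z) p v) 0 := by
    have hF : DifferentiableAt ℝ (fun y ↦ bilin M a y Y Z) p :=
      OpensChart.differentiableAt_apply₂ (bilin M a) hd Y Z
    have hl : HasDerivAt (fun s : ℝ ↦ p + s • v) v 0 := by
      simpa using ((hasDerivAt_id (0 : ℝ)).smul_const v).const_add p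
    exact hF.hasFDerivAt.comp_hasDerivAt_of_eq (0 : ℝ) hl (by simp)
  rw [← OpensChart.fderiv_apply₂ (bilin M a) hd Y Z v]
  exact h1.unique hD

end Line

/-! ### The transversal derivative vanishes on `{z = 0}` (reflection symmetry `z ↦ −z`) -/

/-- The reflection `z ↦ −z` of `E4`. [folklore] -/
def reflectThree (x : E4) : E4 := x - (2 * x 3) • E4.basisVector 3

/-- Coordinates of the reflected point. [folklore] -/
theorem reflectThree_apply (x : E4) (μ : Fin 4) :
    reflectThree x μ = if μ = 3 then -x 3 else x μ := by
  fin_cases μ <;> simp [reflectThree]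
  ring

/-- The Kerr–Schild radius is even in `z`. Visser arXiv:0706.0622, (35).
[cite: arXiv07060622, (35)] -/
theorem radius_reflectThree (a : ℝ) (x : E4) : radius a (reflectThree x) = radius a x := by
  simp [radius, E4.spatialNorm_sq, reflectThree_apply]

/-- The Kerr–Schild scalar `H` is even in `z`. Visser arXiv:0706.0622, (33).
[cite: arXiv07060622, (33)] -/
theorem scalarH_reflectThree (M a : ℝ) (x : E4) : scalarH M a (reflectThree x) = scalarH M a x := by
  simp [scalarH, radius_reflectThree, reflectThree_apply]

/-- `ℓ(w)` is even in `z` for `w` tangent to `{z = const}` (`w³ = 0`): the components `ℓ₀, ℓ₁, ℓ₂`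
are even and `ℓ₃ = z/r` is odd. Visser arXiv:0706.0622, (34). [cite: arXiv07060622, (34)] -/
theorem nullCovector_reflectThree (a : ℝ) (x : E4) {w : E4} (hw : w 3 = 0) :
    nullCovector a (reflectThree x) w = nullCovector a x w := by
  rw [nullCovector_apply, nullCovector_apply, radius_reflectThree]
  simp [reflectThree_apply, hw]

/-- `g(w, w)` is even in `z` for `w³ = 0`. [cite: arXiv07060622, (32)] -/
theorem bilin_reflectThree (M a : ℝ) (x : E4) {w : E4} (hw : w 3 = 0) :
    bilin M a (reflectThree x) w w = bilin M a x w w := by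
  rw [bilin_apply, bilin_apply, scalarH_reflectThree, nullCovector_reflectThree a x hw]

/-- The derivative at `0` of an even differentiable function vanishes. [folklore] -/
theorem hasDerivAt_zero_of_even {f : ℝ → ℝ} {d : ℝ} (hf : HasDerivAt f d 0)
    (heven : ∀ t, f (-t) = f t) : d = 0 := by
  have h1 : HasDerivAt (fun t ↦ f (-t)) (-d) 0 := by
    have := hf.scomp_of_eq (0 : ℝ) (hasDerivAt_neg (0 : ℝ)) (by simp)
    rw [neg_one_smul] at this
    exact this
  have h2 : (fun t ↦ f (-t)) = f := funext heven
  rw [h2] at h1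
  linarith [hf.unique h1]

/-- **`∂_z g_p(w, w) = 0` on `{z = 0}` for `w³ = 0`**: the line `t ↦ p + t ∂_z` is reflected onto
itself by `z ↦ −z`, under which `g(w, w)` is invariant. [cite: arXiv07060622, (32)] -/
theorem fderiv_bilin_basisVector_three_eq_zero (M a : ℝ) {p w : E4} (hp3 : p 3 = 0)
    (hw : w 3 = 0) (hd : DifferentiableAt ℝ (bilin M a) p) :
    fderiv ℝ (bilin M a) p (E4.basisVector 3) w w = 0 := by
  have h1 : HasDerivAt (fun s : ℝ ↦ bilin M a (p + s • E4.basisVector 3) w w)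
      (fderiv ℝ (fun y ↦ bilin M a y w w) p (E4.basisVector 3)) 0 := by
    have hF : DifferentiableAt ℝ (fun y ↦ bilin M a y w w) p :=
      OpensChart.differentiableAt_apply₂ (bilin M a) hd w w
    have hl : HasDerivAt (fun s : ℝ ↦ p + s • E4.basisVector 3) (E4.basisVector 3) 0 := by
      simpa using ((hasDerivAt_id (0 : ℝ)).smul_const (E4.basisVector 3)).const_add p
    exact hF.hasFDerivAt.comp_hasDerivAt_of_eq (0 : ℝ) hl (by simp)
  rw [← OpensChart.fderiv_apply₂ (bilin M a) hd w w (E4.basisVector 3)]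
  refine hasDerivAt_zero_of_even h1 fun t ↦ ?_
  have hrefl : reflectThree (p + t • E4.basisVector 3) = p + (-t) • E4.basisVector 3 := by
    ext μ
    rw [reflectThree_apply]
    fin_cases μ <;> simp [hp3]
  rw [← hrefl, bilin_reflectThree M a _ hw]

end Kerr

end Literature.Geometry.Lorentzian

end
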